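import Mathlib.RingTheory.Polynomial.Hermite.Basic
import Summits.QuantumFields.BalabanUV.T4Continuum.Spine.NE4.AutonomousScheme

/-!
# Spine/NE4/GaussianBlockSpectrum — (R57) THE LORE RATE COMPUTED: the Gaussian linearisation of the hierarchical block map in `d = 4` is DIAGONAL on
# Wick monomials with factor `L^{4−n}`; degree 4 is MARGINAL (factor 1 — the parabolic direction of (R54), the coupling that (R42) extracts), degree 6
# carries `L⁻²` — the row's «expected rate θ = L⁻²», so far labelled LORE, now a kernel MODEL statement (Mehler ∕ Ornstein–Uhlenbeck eigenrelation)

Cell `pub-balaban-gaps` (YM blitz G2), seat `ne4`, generation 16 (unit `pub-balaban-gaps-ne4-g16`); record `HOME/ne/NE4.md` §5 (R57).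

HONEST FRAMING.  NE4 = `T4CouplingMatching.ScaleShiftRate` — Bałaban's β-functions forget the ultraviolet cutoff geometrically fast — is NOT IN PRINT
([Balaban1987RG1] = CMP **109** (1987) p. 264 «We will investigate other properties in a separate paper») and NOT proved.  This file is pure polynomial
algebra over `ℝ` (Mathlib's `Polynomial.hermite`, a moment functional, finite sums): a MODEL computation at the GAUSSIAN fixed point of the HIERARCHICAL
(local-potential) block-spin map — NOT Bałaban's renormalization operation RT, NOT lattice gauge theory, no status word moves (NE4 stays DEPENDENT; spine
0∕9).  One finite T⁴ is the cell's target; NOT ℝ⁴, NOT infinite volume, NOT a mass gap, NOT Clay.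

THE POINT (sixteenth reader).  The row's item 8 ∕ TL;DR (6) carries ONE number for NE4's rate, `θ = L⁻²` («the leading irrelevant eigenvalue», Hasenfratz–Niedermayer
NPB **414** (1994) §2.7; Wieczerkowski NPB **488** (1997) «not yet formalized»), labelled LORE; the autonomous road asks for exactly such a datum ((R45)
`AutonomousSchemeSpectral`: spectral radius of the Gaussian linearisation `T₀` of RT after extracting the marginal coupling; (R43) a contracting power of `T₀`), and
(R54)∕(R55) showed that a MARGINAL direction left inside the state is what separates King's rate-free currency from NE4.  Here the datum is COMPUTED in the one
model where the Gaussian linearisation is explicit — the hierarchical ∕ local-potential block map (Wilson's approximate recursion; Gawȩdzki–Kupiainen; Felder CMP **111**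
(1987); Bauerschmidt–Brydges–Slade LNM **2242** §§1.7–4.1 for the dimension count) — by the Ornstein–Uhlenbeck (Mehler) eigenrelation:
* §1 `gMoment s n` (the moments `s^{n∕2}(n−1)‼` ∕ `0` of the centred Gaussian of variance `s`), the linear functional `gaussE s : ℝ[X] →ₗ[ℝ] ℝ` they define, and the
  WICK–STEIN identity `gaussE s (X·p) = s · gaussE s p′` (`gaussE_X_mul`) — Gaussian integration by parts as an identity of the moment sequence (`gMoment_succ`).
* §2 the probabilists' Hermite polynomials `He n = map ℤ→ℝ (Polynomial.hermite n)` (Wick powers `:xⁿ:` of the unit Gaussian), the APPELL property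
  `(He (n+1))′ = (n+1)·He n` (`derivative_He_succ`, not in Mathlib) and the three-term recurrence `He (n+2) = X·He (n+1) − (n+1)·He n`.
* §3 **MEHLER's EIGENRELATION** `gaussE (1 − a²) ((He n).comp (C (a·x) + X)) = aⁿ · (He n).eval x` (`gaussE_He_affine`): averaging the Wick power of degree `n` over a
  fluctuation of variance `1 − a²` about the rescaled point `a·x` returns `aⁿ` times the Wick power — two-step induction from §1∕§2, no integral; and the WICK
  PROPERTY `gaussE 1 (He n · He m) = n!·δ_{nm}` (`gaussE_one_He_mul_He`: the `He n` ARE the orthogonal polynomials ∕ Wick powers of the unit Gaussian).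
* §4 the LINEARISED BLOCK MAP `blockLin vol a V x = vol · gaussE (1 − a²) (V.comp (C (a·x) + X))` — `vol = L^d` sites per block, field rescaling `a = L^{−(d−2)∕2}`,
  fluctuation variance `1 − a²` fixed by self-similarity of the unit Gaussian — is DIAGONAL on Wick powers: `blockLin vol a (He n) x = vol·aⁿ·(He n).eval x`
  (`blockLin_He`); in `d = 4` (`vol = L⁴`, `a = L⁻¹`): factor `L⁴·L⁻ⁿ` (`blockLin4_He`), i.e. `L²` at `n = 2` (RELEVANT — a mass; no gauge-invariant analogue),
  **`1` at `n = 4` (MARGINAL** — `blockLin4_He_four`: the Wick quartic is reproduced EXACTLY, the parabolic direction of (R54)∕(R55); in Bałaban's model this slot is the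
  `F²` coefficient `1∕g²`, carried as the PARAMETER of the step by (R42)'s design), **`L⁻²` at `n = 6`** (`blockLin4_He_six`: the LEADING EVEN IRRELEVANT direction —
  dimension 6, the slot of `F³` ∕ `(DF)²` —, the row's `θ`), and `≤ L⁻²` on every degree `n ≥ 6` for `L ≥ 1` (`blockFactor_le_of_six_le`); on finite Wick sums
  the map acts coefficientwise (`blockLin4_wickSum`).
* §5 BRIDGE TO THE AUTONOMOUS ROAD's shapes ((R42) `Markov.*`): the truncated irrelevant block — Wick coordinates of degrees `n_i ≥ 6`, state space `Fin m → ℝ` (sup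
  metric), step `A g u = (L^{4−n_i} u_i + g·σ_i)_i` (diagonal Gaussian part + a coupling-proportional one-step source `σ`) — satisfies `Markov.StateContraction A univ L⁻² γ`
  (`stateContraction_wickBlock`), `StateCouplingLipschitz ‖σ‖`, `FirstStep 0 (γ‖σ‖)`, so by (R42)'s kernel EVERY β-family read off its orbit by a `cr`-Lipschitz functional
  has node U2's whole β-side triple at rate `L⁻²` (`scaleShiftRate_wickBlock`, `ne4_triple_wickBlock`) — the first `ScaleShiftRate` in the tree whose rate is COMPUTED
  from a renormalization-group linearisation rather than posited.  A caricature of the mechanism, not of Bałaban's objects.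

WHAT THIS SAYS FOR THE ROW (census (R57); classification words UNCHANGED — DEPENDENT; NOT IN PRINT; NOT PROVED; 0∕9): the number `θ = L⁻²` of item 8 changes label from
LORE to «MODEL (kernel): leading even irrelevant factor of the Gaussian-linearised hierarchical block map in d = 4, by Wick-degree ∕ dimension counting `L^{4−n}`; its transfer
to Bałaban's RT (dimension-6 gauge-invariant operators) remains LORE»; and (R54)'s «marginal direction inside the state» is identified concretely as the Wick quartic (factor
exactly 1).  Consistent with the cell's own MODEL data: (R50) (massless scalar, δ-block averaging, two lineages) measured the linear block covariance converging at `θ = L⁻²`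
EXACTLY and the one-loop marginal coefficient at `θ = L⁻²` asymptotically; (R44) (Migdal–Kadanoff, scale factor λ) measured `λ⁻⁴` — the rate is SCHEME-BOUND; this file's
`L^{d − n(d−2)∕2}` is the block-spin scheme's count.  NOT PRINTED for lattice gauge theory; nothing of Bałaban's asserted; NE4 NOT proved. -/

noncomputable section

namespace Summit.QuantumFields.BalabanUV.T4Continuum.Spine.NE4

open Polynomial Finset
open scoped Nat

namespace GaussianBlock

/-! ## §1 The centred Gaussian moment functional on `ℝ[X]` and the Wick–Stein identity -/

section Moments

/-- The moments of the centred Gaussian law of variance `s`: `m_s(n) = s^{n∕2}·(n−1)‼` for even `n`, `0` for odd `n` (for `s < 0` a formal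
moment sequence; only the algebra is used). [folklore] -/
def gMoment (s : ℝ) (n : ℕ) : ℝ := if Even n then s ^ (n / 2) * ((n - 1)‼ : ℕ) else 0

/-- [bookkeeping] `m_s(0) = 1` (total mass one). [folklore] -/
theorem gMoment_zero (s : ℝ) : gMoment s 0 = 1 := by simp [gMoment]

/-- [bookkeeping] `m_s(1) = 0` (centred). [folklore] -/
theorem gMoment_one (s : ℝ) : gMoment s 1 = 0 := by simp [gMoment]

/-- **THE GAUSSIAN MOMENT RECURSION** `m_s(k+2) = s·(k+1)·m_s(k)` — integration by parts `E[ζ·ζ^{k+1}] = s·E[(k+1)ζ^k]` as an identity of the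
closed-form moments (`(k+1)‼ = (k+1)·(k−1)‼`). [folklore] -/
theorem gMoment_succ_succ (s : ℝ) (k : ℕ) : gMoment s (k + 2) = s * (k + 1) * gMoment s k := by
  unfold gMoment
  have hiff : Even (k + 2) ↔ Even k := by simp [Nat.even_add]
  by_cases hk : Even k
  · rw [if_pos (hiff.mpr hk), if_pos hk]
    have h1 : (k + 2) / 2 = k / 2 + 1 := by omega
    have h2 : k + 2 - 1 = k + 1 := by omega
    rw [h1, h2, Nat.doubleFactorial_add_one, pow_succ]
    push_cast
    ring
  · rw [if_neg (fun h => hk (hiff.mp h)), if_neg hk]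
    ring

/-- [bookkeeping] The recursion in the shifted form used by the Wick–Stein identity: `m_s(n+1) = s·n·m_s(n−1)` (both sides `0` at `n = 0`). [folklore] -/
theorem gMoment_succ (s : ℝ) (n : ℕ) : gMoment s (n + 1) = s * n * gMoment s (n - 1) := by
  rcases n with _ | k
  · simp [gMoment_one]
  · rw [Nat.add_sub_cancel, show k + 1 + 1 = k + 2 from rfl, gMoment_succ_succ]
    push_cast
    ring

/-- **THE GAUSSIAN FUNCTIONAL ON POLYNOMIALS** `E_s[p(ζ)] = Σ_n p_n·m_s(n)` — the expectation of a polynomial under the centred Gaussian of variance `s`, as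
the `ℝ`-linear functional on `ℝ[X]` determined by the moment sequence (no measure theory is invoked; for `0 ≤ s` it IS the Gaussian integral, a fact not
used here). [folklore] -/
def gaussE (s : ℝ) : ℝ[X] →ₗ[ℝ] ℝ := Polynomial.lsum fun n => gMoment s n • LinearMap.id

/-- [bookkeeping] `E_s[p] = Σ_n m_s(n)·p_n`. [folklore] -/
theorem gaussE_apply (s : ℝ) (p : ℝ[X]) : gaussE s p = p.sum fun n a => gMoment s n * a := by
  simp [gaussE, Polynomial.lsum_apply]

/-- [bookkeeping] On monomials: `E_s[a·ζⁿ] = m_s(n)·a`. [folklore] -/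
theorem gaussE_monomial (s : ℝ) (n : ℕ) (a : ℝ) : gaussE s (monomial n a) = gMoment s n * a := by
  rw [gaussE_apply, sum_monomial_index]
  simp

/-- [bookkeeping] Constants: `E_s[c] = c`. [folklore] -/
theorem gaussE_C (s c : ℝ) : gaussE s (C c) = c := by rw [← monomial_zero_left, gaussE_monomial, gMoment_zero, one_mul]

/-- [bookkeeping] `E_s[1] = 1`. [folklore] -/
theorem gaussE_one (s : ℝ) : gaussE s 1 = 1 := by rw [← C_1, gaussE_C]

/-- [bookkeeping] `E_s[ζ] = 0`. [folklore] -/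
theorem gaussE_X (s : ℝ) : gaussE s X = 0 := by rw [← monomial_one_one_eq_X, gaussE_monomial, gMoment_one, zero_mul]

/-- [bookkeeping] `E_s[c·p] = c·E_s[p]`. [folklore] -/
theorem gaussE_C_mul (s c : ℝ) (p : ℝ[X]) : gaussE s (C c * p) = c * gaussE s p := by rw [← smul_eq_C_mul, map_smul, smul_eq_mul]

/-- **THE WICK–STEIN IDENTITY** `E_s[ζ·p(ζ)] = s·E_s[p′(ζ)]` — Gaussian integration by parts, here an identity of the moment functional (linearity + the
moment recursion `gMoment_succ` on monomials). [folklore] -/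
theorem gaussE_X_mul (s : ℝ) (p : ℝ[X]) : gaussE s (X * p) = s * gaussE s (derivative p) := by
  induction p using Polynomial.induction_on' with
  | add p q hp hq => rw [mul_add, map_add, map_add, map_add, hp, hq, mul_add]
  | monomial n a =>
    rw [X_mul_monomial, gaussE_monomial, derivative_monomial, gaussE_monomial, gMoment_succ]
    ring

end Moments

/-! ## §2 The probabilists' Hermite polynomials over `ℝ` (Wick powers of the unit Gaussian): Appell property and three-term recurrence -/

section Hermite

/-- The probabilists' HERMITE POLYNOMIAL `He n ∈ ℝ[X]` — Mathlib's `Polynomial.hermite n ∈ ℤ[X]` (`He_{n+1} = X·He_n − He_n′`) mapped to `ℝ`; the Wick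
power `:xⁿ:` of the unit Gaussian. [folklore] -/
def He (n : ℕ) : ℝ[X] := Polynomial.map (Int.castRingHom ℝ) (Polynomial.hermite n)

/-- [bookkeeping] `He 0 = 1`. [folklore] -/
theorem He_zero : He 0 = 1 := by simp [He, hermite_zero]

/-- [bookkeeping] `He 1 = X`. [folklore] -/
theorem He_one : He 1 = X := by simp [He]

/-- [bookkeeping] Mathlib's defining recurrence over `ℝ`: `He (n+1) = X·He n − (He n)′`. [folklore] -/
theorem He_succ (n : ℕ) : He (n + 1) = X * He n - derivative (He n) := by
  simp only [He, hermite_succ, Polynomial.map_sub, Polynomial.map_mul, map_X, derivative_map]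

/-- **THE APPELL PROPERTY** `(He (n+1))′ = (n+1)·He n` (not in Mathlib; induction: `He_{n+2}′ = He_{n+1} + X·He_{n+1}′ − He_{n+1}″ = He_{n+1} + (n+1)(X·He_n − He_n′)`).
[folklore] -/
theorem derivative_He_succ (n : ℕ) : derivative (He (n + 1)) = C ((n : ℝ) + 1) * He n := by
  induction n with
  | zero => simp [He_one, He_zero]
  | succ n ih =>
    rw [He_succ (n + 1), derivative_sub, derivative_mul, derivative_X, one_mul, ih, derivative_C_mul, He_succ n]
    simp only [Nat.cast_add, Nat.cast_one, map_add, map_one]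
    ring

/-- **THE THREE-TERM RECURRENCE** `He (n+2) = X·He (n+1) − (n+1)·He n`. [folklore] -/
theorem He_succ_succ (n : ℕ) : He (n + 2) = X * He (n + 1) - C ((n : ℝ) + 1) * He n := by
  rw [show n + 2 = n + 1 + 1 from rfl, He_succ (n + 1), derivative_He_succ]

/-- [bookkeeping] The recurrence under evaluation: `He_{n+2}(x) = x·He_{n+1}(x) − (n+1)·He_n(x)`. [folklore] -/
theorem eval_He_succ_succ (n : ℕ) (x : ℝ) :
    (He (n + 2)).eval x = x * (He (n + 1)).eval x - ((n : ℝ) + 1) * (He n).eval x := by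
  rw [He_succ_succ, eval_sub, eval_mul, eval_X, eval_mul, eval_C]

end Hermite

/-! ## §3 Mehler's eigenrelation: the Gaussian average of a Wick power about a rescaled point -/

section Mehler

/-- [bookkeeping] Differentiating through the affine substitution `ζ ↦ c + ζ`: `(p ∘ (c + X))′ = p′ ∘ (c + X)`. [folklore] -/
theorem derivative_comp_C_add_X (p : ℝ[X]) (c : ℝ) :
    derivative (p.comp (C c + X)) = (derivative p).comp (C c + X) := by
  rw [derivative_comp, derivative_add, derivative_C, derivative_X, zero_add, one_mul]

/-- **MEHLER's (ORNSTEIN–UHLENBECK) EIGENRELATION**: for every `a, x ∈ ℝ` and every degree `n`,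
`E_{1−a²}[He_n(a·x + ζ)] = aⁿ·He_n(x)` — the Wick power of degree `n`, averaged over a centred Gaussian fluctuation of variance `1 − a²` about the rescaled
point `a·x`, is reproduced with the factor `aⁿ`.  Two-step induction on `n` from the three-term recurrence, the Appell property and the Wick–Stein identity:
`E[(ax+ζ)He_{n+1}(ax+ζ)] = ax·a^{n+1}He_{n+1}(x) + (1−a²)(n+1)aⁿHe_n(x)`. [folklore] -/
theorem gaussE_He_affine (a x : ℝ) (n : ℕ) :
    gaussE (1 - a ^ 2) ((He n).comp (C (a * x) + X)) = a ^ n * (He n).eval x := by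
  induction n using Nat.twoStepInduction with
  | zero => simp [He_zero, gaussE_one]
  | one =>
    rw [He_one, X_comp, map_add, gaussE_C, gaussE_X, eval_X]
    ring
  | more n h0 h1 =>
    rw [eval_He_succ_succ, He_succ_succ, sub_comp, mul_comp, X_comp, mul_comp, C_comp, add_mul, map_sub, map_add, gaussE_C_mul,
      gaussE_X_mul, derivative_comp_C_add_X, derivative_He_succ, mul_comp, C_comp, gaussE_C_mul, h0, h1]
    ring

/-- [bookkeeping] The case `a = 0` (pure fluctuation of unit variance): `E_1[He_n(ζ)] = 0` for `n ≥ 1` — Wick powers are centred. [folklore] -/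
theorem gaussE_one_He_succ (n : ℕ) : gaussE 1 (He (n + 1)) = 0 := by
  have h := gaussE_He_affine 0 0 (n + 1)
  simp only [mul_zero, map_zero, zero_add, comp_X, ne_eq, Nat.add_eq_zero_iff, one_ne_zero, and_false,
    not_false_eq_true, zero_pow, zero_mul] at h
  simpa using h

/-- [bookkeeping] ONE STEP OF THE ORTHOGONALITY RECURSION: `E_1[He_{n+1}·He_m] = E_1[He_n·He_m′]` — `He_{n+1} = X·He_n − He_n′`, the Wick–Stein
identity at `s = 1` and the Leibniz rule. [folklore] -/
theorem gaussE_one_He_succ_mul (n m : ℕ) : gaussE 1 (He (n + 1) * He m) = gaussE 1 (He n * derivative (He m)) := by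
  rw [He_succ, sub_mul, map_sub, mul_assoc, gaussE_X_mul, one_mul, derivative_mul, map_add]
  ring

/-- **THE WICK PROPERTY (orthogonality)**: `E_1[He_n·He_m] = n!·δ_{nm}` — the `He n` are the orthogonal polynomials of the unit Gaussian, i.e. its
Wick powers; so §4's «degree `n`» is the Wick degree. [folklore] -/
theorem gaussE_one_He_mul_He (n m : ℕ) : gaussE 1 (He n * He m) = if n = m then (n ! : ℝ) else 0 := by
  induction n generalizing m with
  | zero =>
    rcases m with _ | k
    · simp [He_zero, gaussE_one]
    · rw [He_zero, one_mul, gaussE_one_He_succ, if_neg (by omega)]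
  | succ n ih =>
    rcases m with _ | k
    · rw [gaussE_one_He_succ_mul, He_zero, derivative_one, mul_zero, map_zero, if_neg (by omega)]
    · rw [gaussE_one_He_succ_mul, derivative_He_succ, mul_left_comm, gaussE_C_mul, ih k]
      by_cases hnk : n = k
      · subst hnk
        rw [if_pos rfl, if_pos rfl, Nat.factorial_succ]
        push_cast
        ring
      · rw [if_neg hnk, if_neg (by omega), mul_zero]

end Mehler

/-! ## §4 The linearised hierarchical block map: diagonal on Wick powers; `d = 4`: factor `L^{4−n}` -/

section Block

/-- THE LINEARISED BLOCK MAP at the Gaussian fixed point of the hierarchical ∕ local-potential block-spin transformation: `vol` (= `L^d`) sites per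
block, block field entering each site as `a·x` (`a = L^{−(d−2)∕2}`, the canonical rescaling), independent single-site fluctuation of variance `1 − a²`
(self-similarity of the unit Gaussian: `a² + (1 − a²) = 1`); acting on a single-site potential perturbation `V ∈ ℝ[X]`:
`(T V)(x) = vol · E_{1−a²}[V(a·x + ζ)]`.  A MODEL object (Wilson's approximate recursion linearised); NOT Bałaban's RT. [folklore] -/
def blockLin (vol a : ℝ) (V : ℝ[X]) (x : ℝ) : ℝ := vol * gaussE (1 - a ^ 2) (V.comp (C (a * x) + X))

/-- [bookkeeping] Linearity of the block map in the perturbation. [folklore] -/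
theorem blockLin_add (vol a : ℝ) (V W : ℝ[X]) (x : ℝ) :
    blockLin vol a (V + W) x = blockLin vol a V x + blockLin vol a W x := by
  simp only [blockLin, add_comp, map_add, mul_add]

/-- [bookkeeping] Homogeneity of the block map in the perturbation. [folklore] -/
theorem blockLin_smul (vol a c : ℝ) (V : ℝ[X]) (x : ℝ) : blockLin vol a (c • V) x = c * blockLin vol a V x := by
  simp only [blockLin, smul_comp, map_smul, smul_eq_mul]
  ring

/-- **THE BLOCK MAP IS DIAGONAL ON WICK POWERS**: `T(He_n)(x) = vol·aⁿ·He_n(x)` — in dimension `d` with scale `L` (`vol = L^d`, `a = L^{−(d−2)∕2}`) the factor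
is `L^{d − n(d−2)∕2}` (relevant for `n(d−2) < 2d`, marginal at equality, irrelevant beyond). [folklore] -/
theorem blockLin_He (vol a x : ℝ) (n : ℕ) : blockLin vol a (He n) x = vol * a ^ n * (He n).eval x := by
  rw [blockLin, gaussE_He_affine, mul_assoc]

/-- THE `d = 4` BLOCK MAP with scale `L`: `vol = L⁴`, `a = L⁻¹` (canonical dimension `[φ] = 1`), fluctuation variance `1 − L⁻²`. [folklore] -/
def blockLin4 (L : ℝ) : ℝ[X] → ℝ → ℝ := blockLin (L ^ 4) L⁻¹

/-- THE `d = 4` FACTOR of the Wick power of degree `n`: `L⁴·L⁻ⁿ = L^{4−n}`. [folklore] -/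
def blockFactor (L : ℝ) (n : ℕ) : ℝ := L ^ 4 * L⁻¹ ^ n

/-- **`d = 4`: DEGREE `n` CARRIES THE FACTOR `L^{4−n}`** — `T(He_n)(x) = L⁴·L⁻ⁿ·He_n(x)`. [folklore] -/
theorem blockLin4_He (L x : ℝ) (n : ℕ) : blockLin4 L (He n) x = blockFactor L n * (He n).eval x := by rw [blockLin4, blockLin_He, blockFactor]

/-- [bookkeeping] The factor as an integer power: `blockFactor L n = L^{4−n}` (`L ≠ 0`). [folklore] -/
theorem blockFactor_eq_zpow {L : ℝ} (hL : L ≠ 0) (n : ℕ) : blockFactor L n = L ^ ((4 : ℤ) - n) := by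
  rw [blockFactor, zpow_sub₀ hL, zpow_ofNat, zpow_natCast, inv_pow, div_eq_mul_inv]

/-- **RELEVANT, MARGINAL, LEADING IRRELEVANT**: the factors at degrees 2, 4, 6 are `L²`, `1`, `L⁻²` (`L ≠ 0`). [folklore] -/
theorem blockFactor_two_four_six {L : ℝ} (hL : L ≠ 0) :
    blockFactor L 2 = L ^ 2 ∧ blockFactor L 4 = 1 ∧ blockFactor L 6 = L⁻¹ ^ 2 := by
  refine ⟨?_, ?_, ?_⟩ <;> rw [blockFactor] <;> field_simp

/-- **THE MARGINAL DIRECTION**: the Wick QUARTIC is reproduced EXACTLY by the `d = 4` block map — `T(He_4) = He_4` (factor 1: no margin in this direction;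
(R54)'s parabolic slot; in (R42)'s design the corresponding coordinate — for Bałaban the `F²` coefficient — is the extracted coupling). [folklore] -/
theorem blockLin4_He_four {L : ℝ} (hL : L ≠ 0) (x : ℝ) : blockLin4 L (He 4) x = (He 4).eval x := by
  rw [blockLin4_He, (blockFactor_two_four_six hL).2.1, one_mul]

/-- **THE LORE RATE**: the leading EVEN irrelevant Wick power (degree 6 — dimension 6) carries EXACTLY `L⁻²`: `T(He_6) = L⁻²·He_6`. [folklore] -/
theorem blockLin4_He_six {L : ℝ} (hL : L ≠ 0) (x : ℝ) : blockLin4 L (He 6) x = L⁻¹ ^ 2 * (He 6).eval x := by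
  rw [blockLin4_He, (blockFactor_two_four_six hL).2.2]

/-- [bookkeeping] The factors are positive for `L > 0`. [folklore] -/
theorem blockFactor_pos {L : ℝ} (hL : 0 < L) (n : ℕ) : 0 < blockFactor L n := by
  unfold blockFactor; positivity

/-- [bookkeeping] The factors decrease with the degree for `L ≥ 1`: `blockFactor L (n+1) ≤ blockFactor L n`. [folklore] -/
theorem blockFactor_succ_le {L : ℝ} (hL : 1 ≤ L) (n : ℕ) : blockFactor L (n + 1) ≤ blockFactor L n := by
  have hL0 : 0 < L := lt_of_lt_of_le one_pos hL
  have hinv : L⁻¹ ≤ 1 := inv_le_one_of_one_le₀ hL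
  unfold blockFactor
  rw [pow_succ]
  have h1 : 0 ≤ L ^ 4 * L⁻¹ ^ n := by positivity
  calc L ^ 4 * (L⁻¹ ^ n * L⁻¹) = (L ^ 4 * L⁻¹ ^ n) * L⁻¹ := by ring
    _ ≤ (L ^ 4 * L⁻¹ ^ n) * 1 := mul_le_mul_of_nonneg_left hinv h1
    _ = L ^ 4 * L⁻¹ ^ n := mul_one _

/-- [bookkeeping] Monotonicity in the degree: `m ≤ n ⇒ blockFactor L n ≤ blockFactor L m` (`L ≥ 1`). [folklore] -/
theorem blockFactor_antitone {L : ℝ} (hL : 1 ≤ L) {m n : ℕ} (hmn : m ≤ n) : blockFactor L n ≤ blockFactor L m := by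
  induction n, hmn using Nat.le_induction with
  | base => exact le_rfl
  | succ n _ ih => exact (blockFactor_succ_le hL n).trans ih

/-- **EVERY IRRELEVANT EVEN DEGREE IS DOMINATED BY THE LEADING ONE**: for `L ≥ 1` and `n ≥ 6`, `0 < blockFactor L n ≤ L⁻²` — on the span of the Wick
powers of degree `≥ 6` the `d = 4` block map contracts every coordinate by at least `L⁻²`, with equality at degree 6. [folklore] -/
theorem blockFactor_le_of_six_le {L : ℝ} (hL : 1 ≤ L) {n : ℕ} (hn : 6 ≤ n) : blockFactor L n ≤ L⁻¹ ^ 2 := by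
  have hL0 : L ≠ 0 := (lt_of_lt_of_le one_pos hL).ne'
  rw [← (blockFactor_two_four_six hL0).2.2]
  exact blockFactor_antitone hL hn

/-- A FINITE WICK SUM `Σ_{n<N} u_n · He_n` (an even∕odd local perturbation given by its Wick coordinates `u`). [folklore] -/
def wickSum (N : ℕ) (u : ℕ → ℝ) : ℝ[X] := ∑ n ∈ range N, u n • He n

/-- **THE BLOCK MAP ACTS COEFFICIENTWISE ON WICK COORDINATES**: `T(Σ u_n He_n)(x) = Σ L^{4−n} u_n He_n(x)`. [folklore] -/
theorem blockLin4_wickSum (L : ℝ) (N : ℕ) (u : ℕ → ℝ) (x : ℝ) :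
    blockLin4 L (wickSum N u) x = ∑ n ∈ range N, blockFactor L n * u n * (He n).eval x := by
  unfold wickSum blockLin4
  induction N with
  | zero => simp [blockLin]
  | succ N ih =>
    rw [sum_range_succ, sum_range_succ, blockLin_add, ih, blockLin_smul, ← blockLin4, blockLin4_He]
    ring

end Block

/-! ## §5 Bridge to the autonomous road ((R42) `Markov.*`): the truncated irrelevant block is a state contraction at rate `L⁻²` -/

section Bridge

open Literature.MathematicalPhysics.QuantumFieldTheory.Balaban1983to89.FlowStep (HBeta)
open Literature.MathematicalPhysics.QuantumFieldTheory.Balaban1983to89.T4CouplingMatching (ScaleShiftRate HistLipschitz FadingMemory)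

variable {m : ℕ}

/-- THE TRUNCATED IRRELEVANT BLOCK AS AN AUTONOMOUS SCHEME: Wick coordinates `u : Fin m → ℝ` of degrees `deg i` (all `≥ 6`), sup metric; the step at
coupling `g` is the diagonal Gaussian part `L^{4 − deg i}` plus a coupling-proportional one-step source `g·σ_i` (what the step generates from the bare state).
A caricature of (R42)'s `A g` on the irrelevant directions; NOT Bałaban's RT. [folklore] -/
def wickBlockStep (L : ℝ) (deg : Fin m → ℕ) (σ : Fin m → ℝ) (g : ℝ) (u : Fin m → ℝ) : Fin m → ℝ :=
  fun i => blockFactor L (deg i) * u i + g * σ i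

/-- **STATE CONTRACTION AT THE LORE RATE**: for `L ≥ 1` and all degrees `≥ 6` the block step is an `L⁻²`-contraction of the sup metric on the whole state
space, at every coupling — (R42)'s `Markov.StateContraction A univ L⁻² γ` COMPUTED, not posited. [folklore] -/
theorem stateContraction_wickBlock {L : ℝ} (hL : 1 ≤ L) {deg : Fin m → ℕ} (hdeg : ∀ i, 6 ≤ deg i) (σ : Fin m → ℝ) (γ : ℝ) :
    Markov.StateContraction (wickBlockStep L deg σ) Set.univ (L⁻¹ ^ 2) γ := by
  intro g _ _ u _ v _
  refine (dist_pi_le_iff (by positivity)).2 fun i => ?_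
  have hLi : 0 < L := lt_of_lt_of_le one_pos hL
  rw [wickBlockStep, wickBlockStep, Real.dist_eq, show blockFactor L (deg i) * u i + g * σ i - (blockFactor L (deg i) * v i + g * σ i)
      = blockFactor L (deg i) * (u i - v i) by ring, abs_mul, abs_of_pos (blockFactor_pos hLi _)]
  calc blockFactor L (deg i) * |u i - v i| ≤ L⁻¹ ^ 2 * |u i - v i| :=
        mul_le_mul_of_nonneg_right (blockFactor_le_of_six_le hL (hdeg i)) (abs_nonneg _)
    _ = L⁻¹ ^ 2 * dist (u i) (v i) := by rw [Real.dist_eq]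
    _ ≤ L⁻¹ ^ 2 * dist u v := mul_le_mul_of_nonneg_left (dist_le_pi_dist u v i) (by positivity)

/-- [bookkeeping] THE ONE-STEP SOURCE from the bare state `0` has size `≤ γ·‖σ‖` on the coupling box `]0, γ]` — (R42)'s `Markov.FirstStep A 0 (γ‖σ‖) γ`. [folklore] -/
theorem firstStep_wickBlock (L : ℝ) (deg : Fin m → ℕ) (σ : Fin m → ℝ) {γ : ℝ} (hγ : 0 ≤ γ) :
    Markov.FirstStep (wickBlockStep L deg σ) 0 (γ * ‖σ‖) γ := by
  intro g hg0 hgγ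
  refine (dist_pi_le_iff (by positivity)).2 fun i => ?_
  rw [wickBlockStep, Pi.zero_apply, mul_zero, zero_add, Real.dist_eq, sub_zero, abs_mul, abs_of_pos hg0]
  exact mul_le_mul hgγ (norm_le_pi_norm σ i) (abs_nonneg _) hγ

/-- [bookkeeping] THE COUPLING ENTERS LIPSCHITZ: `dist (A g u) (A g′ u) ≤ ‖σ‖·|g − g′|` — (R42)'s `Markov.StateCouplingLipschitz A univ ‖σ‖ γ`. [folklore] -/
theorem stateCouplingLipschitz_wickBlock (L : ℝ) (deg : Fin m → ℕ) (σ : Fin m → ℝ) (γ : ℝ) :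
    Markov.StateCouplingLipschitz (wickBlockStep L deg σ) Set.univ ‖σ‖ γ := by
  intro g g' _ _ _ _ u _
  refine (dist_pi_le_iff (by positivity)).2 fun i => ?_
  rw [wickBlockStep, wickBlockStep, Real.dist_eq, show blockFactor L (deg i) * u i + g * σ i - (blockFactor L (deg i) * u i + g' * σ i)
      = σ i * (g - g') by ring, abs_mul]
  exact mul_le_mul_of_nonneg_right ((Real.norm_eq_abs _).symm.trans_le (norm_le_pi_norm σ i)) (abs_nonneg _)

/-- **NE4's SHAPE AT THE COMPUTED RATE `θ = L⁻²`**: every β-family READ OFF the orbit of the truncated irrelevant block by a `cr`-Lipschitz functional `r`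
((R42)'s `Markov.RepresentsAut`) satisfies `ScaleShiftRate (cr·(γ‖σ‖)·L⁻²) L⁻² γ β` — by (R42)'s kernel `Markov.scaleShiftRate_of_markov` with the contraction of
`stateContraction_wickBlock`.  The first `ScaleShiftRate` in the tree whose rate is COMPUTED from a renormalization-group linearisation (the hierarchical Gaussian one)
rather than posited; a caricature of the mechanism, NOT of Bałaban's objects; NE4 itself is NOT proved. [folklore] -/
theorem scaleShiftRate_wickBlock {L : ℝ} (hL : 1 ≤ L) {deg : Fin m → ℕ} (hdeg : ∀ i, 6 ≤ deg i) (σ : Fin m → ℝ) {γ cr : ℝ}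
    (hγ : 0 ≤ γ) (hcr : 0 ≤ cr) {r : (Fin m → ℝ) → ℝ} (hr : Markov.ReadLipschitzOn r Set.univ cr) {β : HBeta}
    (hrep : Markov.RepresentsAut (wickBlockStep L deg σ) r 0 γ β) :
    ScaleShiftRate (cr * (γ * ‖σ‖) * L⁻¹ ^ 2) (L⁻¹ ^ 2) γ β :=
  Markov.scaleShiftRate_of_markov (by positivity) hcr (fun _ _ _ _ _ => Set.mem_univ _) (Set.mem_univ _)
    (stateContraction_wickBlock hL hdeg σ γ) (firstStep_wickBlock L deg σ hγ) hrep hr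

/-- **NODE U2's WHOLE β-SIDE TRIPLE AT THE COMPUTED RATE**: NE4's shape, the history moduli `Λ k i = cr·‖σ‖·(L⁻²)^{k−i}` and their geometric fading
`FadingMemory (cr‖σ‖) L⁻² Λ` — (R42)'s `Markov.ne4_of_markov` instantiated on the truncated irrelevant block of the hierarchical Gaussian linearisation.
Caricature of the mechanism (linear diagonal step + coupling-proportional source); NOT Bałaban's RT; NE4 NOT proved. [folklore] -/
theorem ne4_triple_wickBlock {L : ℝ} (hL : 1 ≤ L) {deg : Fin m → ℕ} (hdeg : ∀ i, 6 ≤ deg i) (σ : Fin m → ℝ) {γ cr : ℝ}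
    (hγ : 0 ≤ γ) (hcr : 0 ≤ cr) {r : (Fin m → ℝ) → ℝ} (hr : Markov.ReadLipschitzOn r Set.univ cr) {β : HBeta}
    (hrep : Markov.RepresentsAut (wickBlockStep L deg σ) r 0 γ β) :
    ScaleShiftRate (cr * (γ * ‖σ‖) * L⁻¹ ^ 2) (L⁻¹ ^ 2) γ β ∧
      HistLipschitz (fun k i => cr * ‖σ‖ * (L⁻¹ ^ 2) ^ (k - i)) γ β ∧
      FadingMemory (cr * ‖σ‖) (L⁻¹ ^ 2) (fun k i => cr * ‖σ‖ * (L⁻¹ ^ 2) ^ (k - i)) :=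
  Markov.ne4_of_markov (by positivity) hcr (norm_nonneg σ) (fun _ _ _ _ _ => Set.mem_univ _) (Set.mem_univ _)
    (stateContraction_wickBlock hL hdeg σ γ) (stateCouplingLipschitz_wickBlock L deg σ γ) (firstStep_wickBlock L deg σ hγ) hrep hr

end Bridge

end GaussianBlock

end Summit.QuantumFields.BalabanUV.T4Continuum.Spine.NE4
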